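import Literature.NumberTheory.EllipticCurves.CastellaGrossiLeeSkinner2022.BDPValueAtTrivialCharacter
import HarnessLib

/-!
# Yan–Zhu 2026, Thm. 4.12 (first part, integral clause under (Im)) — the anticyclotomic BDP main
# conjecture for `𝒳_{𝓕_Gr}(E/K_∞⁻)` at an ODD good ordinary prime with `ρ̄_E|_{G_K}` irreducible —
# AT THE TRIVIAL CHARACTER, combined with Castella–Grossi–Lee–Skinner 2022 Thm. 5.1.3 (the
# Bertolini–Darmon–Prasanna formula for `L_p^BDP(E/K)(𝟙)`): `𝓕(0) = u · c_E⁻² (1 − a_p p⁻¹ + p⁻¹)²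
# log_{ω_E}(P_K)²` ON THE LITERATURE OBJECT `X_ac` — the `p ≥ 3` twin of
# `BurungaleCastellaSkinner2025/BDPMainConjectureAtTrivialCharacter.lean` (BCS 2025 Thm. 1.2.4 (b),
# printed for `p > 3` under (sur)) — arXiv **v2** NUMBERING AND WORDING (see the ARXIV-VERSION NOTE:
# in v4 = J. Algebra 693 (2026) this is Thm. 5.7, whose integral clause is printed under FULL
# `p`-adic image of `G_K`; the PUBLISHED re-sourcing of the (Im)-integral input is the sibling file
# `CyclotomicBDPCorollaryAtTrivialCharacter.lean`)

ARXIV-VERSION NOTE (2026-08-23; lit GEN 98 `HOME/b2b-bsdres-lit/g98/DRIFT-READS.md` §F1, referee 2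
ruling R2-131.8, GLUE seat gen 12). The text this file read and quotes — the store's
`paper:arxiv-2412.20078` — is arXiv **v2** (2025-01-03; e-print fingerprint, lit GEN 98), NOT v4 as
the locators below were labelled: every "Thm. 4.12 / Conj. 4.10 / Thm. 4.9 / Thm. 4.15 / Thm. 3.12 /
§4.5 / §4.6 / p. 11 / p. 12" in this file is a v2 number/page. Concordance with the CURRENT text
arXiv v3 ≡ **v4** (2026-01-23, the revision carrying doi 10.1016/j.jalgebra.2026.01.016 = J. Algebra
693 (2026) 372–402; journal pages unread, acq-10397): Thm. 4.9 → **5.2** (§5.1), Conj. 4.10 → 5.5,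
Thm. 4.12 → **5.7** (§5.2), Thm. 4.13 → 5.8, Thm. 4.14 → 5.9, Thm. 4.15 → **5.11** (§5.3), Thm. 3.12
(`𝓛_p^BDP`) → 3.13; unchanged: Cor. 1.4, Thm. 1.2 with (Im), Thm. 4.2, Thm. 4.7; Rem. 1.3 rewritten.
DRIFT WITH CONSEQUENCE: v4 Thm. 5.7 prints the integral clause of the anticyclotomic main conjecture
under "the representation `ρ_E|_{G_K} : G_K → Aut_{ℤ_p}(T_pE)` is surjective" (v4 TeX l.1224; proved
via Thm. 5.8 and B. Howard, Compos. Math. 140 (2004) Thm. B), and keeps the (Im) form only as Remark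
5.10: "Via [BSTW, Proposition 12.7], the condition in Theorem 5.7 that `ρ_E|_{G_K}` has full image
can be weakened to condition (Im)." — [BSTW] = arXiv:2409.01350, a PREPRINT. Hence the named fact
below, AS TYPED (binder `BigIm W p` = (Im)), transcribes the v2 wording; in the refereed text its
(Im)-integral clause is a remark resting on a preprint (cell tier R2-131.8: rational clause and
full-image integral clause PUB\*, (Im)-integral clause PRE-dependent). Per the MIS-STATED protocol the
declaration is KEPT UNCHANGED (its meaning is never edited in place; consumers stay kernel-valid
conditionals) and the corrected, PUBLISHED input is vendored BESIDE it: v4 proves its own rank-one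
`p`-part of BSD (Thm. 5.11) no longer from Thm. 5.7 but "from the integral part of Corollary 5.4
[the CYCLOTOMIC analogue of the BDP main conjecture over `K_∞⁺`, integral under (Im)], [CGS,
Proposition 3.4.2], the fact that `𝓛_p^Gr(E/K)⁺(1) = 𝓛_p^Gr(E/K)⁻(1) ≠ 0`, and the descent arguments
in [JSW]" (v4 TeX l.1347) — that chain, minus the descent, is
`YanZhu2026.cor54_prop342_thm513_generator_constantCoeff` (sibling file
`CyclotomicBDPCorollaryAtTrivialCharacter.lean`): the SAME conclusion as the fact below under three
more binders (`rank_ℤ E(K) = 1`, `#Ш(E/K)[p^∞] < ∞`, `P_K` of infinite order — the binders every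
consumer already carries for JSW Thm. 3.3.1), proved there to follow from this fact
(`cor54_prop342_thm513_generator_constantCoeff_of_thm412`). Consumers of `h412` re-key to it by name.

HONEST FRAMING (cell `b2b-bsdres`, run/shared/lean/b2b/bsd-rank1-residual/; page 1 everywhere):
the goal of the cell is to DELETE the COMBINATION-SHAPED residual classes of the BSD formula for ALL
analytic-rank `≤ 1` curves over `ℚ` from PUBLISHED theorems only, so that the remainder becomes
exactly the CONSTRUCTION-SHAPED classes, which are TYPED, not attempted; this is not "finishing
BSD". This file vendors ONE published (refereed) statement as a named fact (`def … : Prop`, nothing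
asserted; D-0014/D-0026) and PROVES its bookkeeping consumers. Unit `b2b-bsdres-lit-glue` (GLUE seat,
gen 7); sized ask A12 of `HOME/b2b-bsdres-lit-glue/GLUE.md` §G6.4 ("Yan–Zhu 2026 Thm 4.12 ∘ BDP
formula at p = 3 as a composite Literature fact on `AcSelmer.XAc` (same shape as File F …) — kills
`hLA3` (C3-ord@3) and feeds `RowC16.bsdp_of_yzThm49_of_thm331`'s `hLA`").

## What and why

The covered IRREDUCIBLE rank-one rows of the cell at the prime `p = 3` (row C16 = Yan–Zhu 2026
Thm. 4.15 at `p = 3`, `r = 1`; row C3 = JSW 2017 Thm. 1.2.1 on its ordinary `p = 3` sub-locus) stand,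
at main-conjecture level, on two links per anticyclotomic datum on the `Λ`-module `X_ac`: the control
link — PUBLISHED at every pair (Jetchev–Skinner–Wan 2017 Thm. 3.3.1 =
`JetchevSkinnerWan2017.thm331_anticyclotomicControl`, `p ≥ 3`) — and the main-conjecture link
(IMC∘BDP)ᵍ `X11b.IMCWaldspurgerOnTreeGoodAt`, fed at `p > 3` by the sibling composite fact
`BurungaleCastellaSkinner2025.thm124b_thm513_generator_constantCoeff` (BCS 2025 Thm. 1.2.4 (b) ∘ CGLS
2022 Thm. 5.1.3; `p > 3`, (sur)) and at `p = 3` by NOTHING in the tree so far (the binders `hLA3` /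
`hLAle3` / `hLA` of `Partition/MainConjecturesIrreducibleBDPClass.lean`,
`…/MainConjecturesCoveredAllPrimesBDP.lean`, `…/MainConjecturesControlJSWClass.lean`). Its printed
source at an odd good ordinary `p` is Yan–Zhu 2026 Thm. 4.12 (the BDP main conjecture, Conj. 4.10,
PROVED rationally under (irr_K) and integrally under (Im), `p > 2`) composed with the BDP formula at
the trivial character, exactly as Yan–Zhu's own proof of Thm. 4.15 composes them ("Choosing an
imaginary quadratic field `K` as above, the rank `1` `p`-part BSD formula comes from (the integral
part of) Theorem 4.12 and descent arguments (see [JSW] for details)", §4.6, p. 12). This file vendors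
that composite in the form established in the cell by `display54_thm513_generator_constantCoeff`
(A173, lit-cgls) and `thm124b_thm513_generator_constantCoeff` (File F, lit-glue gen 6): Thm. 4.12
enters ONLY through "a generator `𝓕` of `ch_Λ(𝒳_{𝓕_Gr}(E/K_∞⁻))` satisfies `𝓕(0) = u · L_p^BDP(E/K)(𝟙)`,
`u ∈ (ℤ_p^ur)^×`" (two generators of a principal ideal of the domain `Λ^{ur,−}` differ by a unit, whose
constant term is a unit of `ℤ_p^ur`), and `L_p^BDP(E/K)(𝟙)` is evaluated by CGLS 2022 Thm. 5.1.3 —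
Yan–Zhu's `𝓛_p^BDP(f/K) ∈ Λ_K^{ur,−}` IS CGLS's `𝓛_E` ("Theorem 3.12 (CGLS)", §3.5, with CGLS's
interpolation formula verbatim). No object for `Λ^ur` / `L_p^BDP` is needed: the identity lives in
`K_v = ℚ_p` with `u ∈ ℚ_p ∩ (ℤ_p^ur)^× = ℤ_p^×` (A173's remark).

## Citation header

* **[YanZhu2024MainConjNonCM]** Xiaojun Yan, Xiuwu Zhu, *Main conjectures for non-CM elliptic curves
  at good ordinary primes*, J. Algebra **693** (2026), doi:10.1016/j.jalgebra.2026.01.016 (=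
  arXiv:2412.20078v4); read by this seat on the store's text `paper:arxiv-2412.20078` = arXiv **v2**
  (p0003 L1–L66, p0005, p0006, p0009 L38–L54, p0011 L30–L120, p0012 L1–L40; numbers and quotations
  below are v2's — ARXIV-VERSION NOTE above for the v4 concordance and the one clause that changed).
  REFEREED / PUBLISHED (the arXiv record carries the journal DOI; sibling files
  `YanZhu2026/CyclotomicMainTheoremIntegral.lean`, `…/PPartBSD.lean`,
  `…/CyclotomicBDPCorollaryAtTrivialCharacter.lean`).
  Conventions (§1, p0003 L4–L9, verbatim): "Fix an odd prime `p` and embeddings `ι_p : ℚ̄ ↪ ℚ̄_p`,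
  `ι_∞ : ℚ̄ ↪ ℂ`. … Suppose that `p = 𝔭𝔭̄` splits in `K`, where `𝔭` is the prime induced by `ι_p`."
  Selmer groups (§2.1, Def. 2.1 and the displays after it, p0005, verbatim): "`H¹_ord(F_w, T_pE ⊗ Λ^∨)
  = Im(H¹(F_w, 𝓕_w⁺T_pE ⊗ Λ^∨) → H¹(F_w, T_pE ⊗ Λ^∨))`, `H¹_rel(F_w, T_pE ⊗ Λ^∨) = H¹(F_w, T_pE ⊗ Λ^∨)`,
  `H¹_str(F_w, T_pE ⊗ Λ^∨) = 0`. Let `Σ` be a set of places of `F` such that `Σ` contains all places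
  of `F` dividing `pN∞`. In the anticyclotomic case, assume moreover that every finite place in `Σ`
  splits in `K`. … `H¹_{𝓕_{a,b}}(K, M) = Ker(H¹(G_{K,Σ}, M) → ∏_{𝔮 ∈ Σ, 𝔮 ∤ p} H¹(K_𝔮, M) ×
  H¹(K_𝔭, M)/H¹_a(K_𝔭, M) × H¹(K_𝔭̄, M)/H¹_b(K_𝔭̄, M))` … `H¹_Gr(K, M) = H¹_{𝓕_{rel,str}}(K, M)` …
  `𝒳_{𝓕_a}(E/K_∞^±) = H¹_{𝓕_a}(K, T_pE ⊗ Λ_K^{±,∨})^∨`" (`Λ^∨` with the `G_K`-action through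
  `ε⁻¹`, p0005 L22) — i.e. `𝒳_{𝓕_Gr}(E/K_∞⁻)` is RELAXED at `𝔭` (induced by `ι_p`) and STRICT at `𝔭̄`
  ("relaxed Selmer conditions at `v = 𝔭` and strict Selmer conditions at `v = 𝔭̄`", §1 p0003 L28).
  BDP `p`-adic `L`-function (§3.5, p0009 L38–L54, verbatim): "Assume that `D_K` is odd and not equal
  to `−3`, and the Heegner hypothesis holds. Fix an integral ideal `𝔫 ⊂ 𝓞_K` with `𝓞_K/𝔫 ≃ ℤ/Nℤ`. Let
  `Λ_K^{ur,−} := Λ_K⁻ ⊗̂ ℤ_p^ur`. **Theorem 3.12 (CGLS).** There exists an element `𝓛_p^BDP(f/K) ∈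
  Λ_K^{ur,−}` characterized by the following interpolation property: for every character `ξ` of `Γ_K⁻`
  crystalline at both `𝔭` and `𝔭̄` and corresponding to a Hecke character of `K` of infinity type
  `(n, −n)` with `n ∈ ℤ_{>0}` and `n ≡ 0 mod p − 1`, we have `𝓛_p^BDP(f/K)(ξ) = (Ω_p^{4n}/Ω_K^{4n}) ·
  Γ(n)Γ(n+1)ξ(𝔫⁻¹)/(4(2π)^{2n+1}√D_K^{2n−1}) · (1 − a_p ξ(𝔭̄)p⁻¹ + ξ(𝔭̄)²p⁻¹)² · L(f/K, ξ, 1)`."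
  **Setting of §4.5** (p0011 L49–L52, verbatim): "Let `E/ℚ` be an elliptic curve of conductor `N`,
  `p > 2` a prime such that `E` has good ordinary reduction at `p`, `K` an imaginary quadratic field
  such that `p = 𝔭𝔭̄` split in `K` and `(E, K)` satisfies the Heegner hypothesis. Assume that residue
  representation `ρ̄_E|_{G_K} : G_K → Aut(E[p])` is irreducible." **Conjecture 4.10** (BDP main
  conjecture): "`𝒳_{𝓕_Gr}(E/K_∞⁻)` is `Λ_K`-torsion and `Char_{Λ_K}(𝒳_{𝓕_ord}(E/K_∞⁻))Λ_K^ur =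
  (𝓛_p^BDP(E/K))`." **Theorem 4.12** (p0011 L66–L75, first part, verbatim): "• `𝒳_{𝓕_Gr}(E/K_∞⁻)` is
  `Λ_K`-torsion and `Char_{Λ_K}(𝒳_{𝓕_ord}(E/K_∞))Λ_K^ur ⊗ ℚ_p = (𝓛_p^BDP(E/K))` holds in `Λ_K ⊗ ℚ_p`.
  Moreover, if (Im) holds, then `Char_{Λ_K}(𝒳_{𝓕_ord}(E/K_∞))Λ_K^ur = (𝓛_p^BDP(E/K))`." with (Im)
  (§1.1, p0003 L61–L66): "there exists `τ ∈ Gal(ℚ̄/ℚ(μ_{p^∞}))` such that `T_pE/(ρ_E(τ) − 1)T_pE`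
  is free of `ℤ_p`-rank one". Proof (p0011 L76 – p0012 L2): Thm. 4.13 (CGS) + Thm. 4.14 (the
  [BCK]-style equivalence HPMC ⇔ BDP-MC) + the two-variable Thm. 4.2 with the `μ = 0` input (4.4)
  [Hsieh] + Lemma 2.7 ("`Char_{Λ_K}(𝒳_{𝓕_Gr}(E/K_∞⁻))Λ_K^ur ⊗ ℚ_p ⊂ (𝓛_p^BDP(E/K))`. The other
  direction divisibility is given by combining Theorem 4.13 and Theorem 4.14. Moreover, if (Im)
  holds, then `Char_{Λ_K}(𝒳_{𝓕_Gr}(E/K_∞))Λ_K^ur ⊂ (𝓛_p^Gr(E/K))` … The remaining part can be deduced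
  from above divisibility and Mazur's main conjecture (Theorem 4.9). See the proof in [BSTW] for
  details."). Use in Thm. 4.15 (§4.6, p0012): "Choosing an imaginary quadratic field `K` as above,
  the rank `1` `p`-part BSD formula comes from (the integral part of) Theorem 4.12 and descent
  arguments (see [JSW] for details)."
  READING FLAG offered to the cell's registry, `YZ26-412-subscript-reading`: the module inside the two
  displayed `Char_{Λ_K}(·)` of Thm. 4.12 (first part) is printed `𝒳_{𝓕_ord}(E/K_∞)` (and in Conj. 4.10
  `𝒳_{𝓕_ord}(E/K_∞⁻)`), while the torsion clause of the same sentence, the title of Conj. 4.10 ("BDP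
  main conjecture"), the right-hand side `𝓛_p^BDP(E/K) ∈ Λ_K^{ur,−}` (a ONE-variable anticyclotomic
  element, Thm. 3.12) and the proof's own conclusion ("`Char_{Λ_K}(𝒳_{𝓕_Gr}(E/K_∞⁻))Λ_K^ur ⊗ ℚ_p ⊂
  (𝓛_p^BDP(E/K))`", p0011 L113) all name `𝒳_{𝓕_Gr}(E/K_∞⁻)`; this file transcribes the statement with
  `𝒳_{𝓕_Gr}(E/K_∞⁻)` (= Conj. 4.10 as its title and §1's Conjecture 1.1 (2) describe it: "relaxed
  Selmer conditions at `v = 𝔭` and strict Selmer conditions at `v = 𝔭̄`"), i.e. it reads the printed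
  subscript `ord`/field `K_∞` in those two displays as misprints for `Gr`/`K_∞⁻`. The flag records the
  reading; it is not a claim that anything printed is false.
  CELL FLAG inherited (referee rulings R9.1/R10.1 on the sibling Thm. 4.15/4.9 files):
  `YZ26@3-BF-ERL-Ohta` — at `p = 3` the two-variable input Thm. 4.2 rests on the Beilinson–Flach
  equivalence Thm. 4.7 printed "Similarly, as [BSTW]" (BSTW = arXiv:2409.01350, a preprint on
  2026-08-21) and on `Λ`-adic explicit reciprocity / Eichler–Shimura inputs in print for `p ≥ 5`; the
  statement vendored is the REFEREED statement, valid as printed at every `p > 2`; no `_holds` is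
  expected.
* **[CastellaGrossiLeeSkinner2022]** Invent. Math. **227** (2022), **Thm. 5.1.3** (verbatim, with
  the data of §5.1.2 — `E/ℚ` of conductor `N`, `π : X₀(N) → E`, `K` with the Heegner hypothesis
  relative to `N`, `𝔑`, `P_K = Σ_σ π(x₁)^σ ∈ E(K)`, `c_E` the Manin constant, `π^*(ω_E) = c_E ω_f`):
  "let `p > 2` be a prime of good reduction for `E` such that `p = v v̄` splits in `K`. Then
  `𝓛_E(0) = c_E⁻² · (1 − a_p p⁻¹ + p⁻¹)² · log_{ω_E}(P_K)²`, where `log_{ω_E} : E(K_v) → K_v` is the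
  formal group logarithm associated to `ω_E`" (arXiv:2008.02571v2 TeX L2463–L2471; read in the cell
  by lit-cgls, `BDPValueAtTrivialCharacter.lean`). Valid at `p = 3`. No reducibility / image
  hypothesis (BDP13 Thm. 5.13 at `k = 2`).

## Transcription (tree vocabulary; every symbol a Literature object; binders = File F's with
## Yan–Zhu's hypotheses in place of BCS Thm. 1.2.4's)

* "`E/ℚ` of conductor `N`, `p > 2` good ordinary" = a globally minimal `W`, `3 ≤ p`, `GoodOrd W p`;
  (Im) = `BigIm W p` (`Rank1Residual/Predicates.lean`, whose docstring cites exactly "Yan–Zhu 2026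
  (Im)"; the same binder as in `YanZhu2026.thm49_charIdeal_eq_padicLFunction_integral`).
* `K`: `IsImaginaryQuadratic K`; Heegner hypothesis for `(E, K)` = `SatisfiesHeegnerHypothesis
  (W.conductorNorm ℤ) K` (every `ℓ ∣ N` splits in `K`; this is what §3.5's "`𝓞_K/𝔫 ≃ ℤ/Nℤ`" and
  §2.1's "every finite place in `Σ` splits in `K`", "`N` prime to `D_K`" use); `p` split =
  `SatisfiesHeegnerHypothesis p K`; §3.5's standing "`D_K` is odd and not equal to `−3`" (under which
  `𝓛_p^BDP` is introduced) = `Odd (discr K) ∧ discr K ≠ -3` — CARRIED as binders (they can only weaken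
  the fact). "`ρ̄_E|_{G_K}` irreducible" = `(W.baseChange K).HasIrreducibleModPGaloisRep p` — the
  tree's irreducibility predicate for the curve over `K`, the SAME binder as (irred_𝒦) of
  `JetchevSkinnerWan2017.thm331_anticyclotomicControl`; NOT replaced by a `ℚ`-level predicate.
* "`𝔭` induced by `ι_p`, `𝔭̄`", "`Γ_K⁻`, `γ⁻`, `Λ_K⁻`", "`𝒳_{𝓕_Gr}(E/K_∞⁻)`": EXACTLY File F's /
  A170's binders: `ι : K →+* ℚ_[p]`, `v` with `x ∈ v ⟺ ‖ι x‖ < 1` (`v = 𝔭`), `vbar ∋ p`, `vbar ≠ v`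
  (`vbar = 𝔭̄`); `κ` anticyclotomic with topological generator `γ`; `𝒳_{𝓕_Gr}(E/K_∞⁻) = AcSelmer.XAc
  (W.baseChange K) p κ vbar ∅ γ` (Castella 2018 Def. 2.2's `X_ac` with STRICT prime `vbar`, relaxed at
  `v`, unramified at `w ∤ p`, `Σ = ∅`; `K_∞`-formulation; Yan–Zhu's "trivial at `𝔮 ∈ Σ`, `𝔮 ∤ p`" and
  "unramified at `𝔮 ∉ Σ`" agree with "unramified at every `w ∤ p`" on `T_pE ⊗ Λ^∨` by their Lemma
  2.2 (1) / the remark in the proof of Lemma 2.3, "in our case, every finite place in `Σ` splits in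
  `K`" — the paper's own identification, as for BCS's `X_Gr` in File F and CGLS's `𝔛_E` in A170/A173).
* "`π`, `c_E`, `𝔑`, `P_K`, `log_{ω_E}(P_K)`": EXACTLY A173's / File F's `(Dt, H, ιC, P)` and the
  element-level log reading `log_W(z(m₀ • P_ι))/m₀` of `PadicFormalLogOrder.lean` (CGLS letter: log
  on `E(K_v)`, `v` induced by `ι`).
* Conclusion: identical in shape to File F's — `𝒳_{𝓕_Gr}` is `Λ`-torsion and there is a generator `F`
  of `ch_Λ(𝒳_{𝓕_Gr})` and `u ∈ ℤ_p^×` with `F(0) = u · c_E⁻² · (1 − a_p p⁻¹ + p⁻¹)² · log_{ω_E}(P_K)²`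
  in `ℚ_p`. COMPOSITE OF TWO PRINTED, PUBLISHED THEOREMS, assembled as Yan–Zhu's proof of Thm. 4.15
  (`r = 1`) assembles them; nothing asserted.

## Contents

* `thm412_thm513_generator_constantCoeff` — the named fact (ONE new `def … : Prop`).
* PROVED: `generator_constantCoeff_eq_of_thm412`, `valuation_generator_constantCoeff_of_thm412`,
  `hasCharValuationAt_of_thm412` (the packaged shape `∃ n, AcSelmer.XAc.HasCharValuationAt … n ∧
  n = 2·(ord_p(1 − a_p + p) − 1 + ord_p log_{ω_E} P_K) − 2·ord_p c_E` — LITERALLY the body of the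
  Summits predicate `X11b.IMCWaldspurgerOnTreeGoodAt p κ vbar γ ι P` up to the Manin term), and
  `thm412_of_bigIm_imp` (bookkeeping: the fact restricted to `3 < p` with (Im) supplied from (sur) by
  any bridge `Surj → BigIm` is File F's binder list plus (irr_K) — so consumers written for File F
  re-key mechanically).

## References
* [YanZhu2024MainConjNonCM] arXiv:2412.20078**v2** (the text read): §1 (conventions, (Im)), §2.1
  (Def. 2.1, `𝒳_{𝓕_Gr}`), §3.5 (Thm. 3.12 = CGLS), §4.5 (setting, Conj. 4.10, Thm. 4.12 and its proof),
  §4.6 (Thm. 4.15 and its proof); = in v4 / J. Algebra 693 (2026): §1, §2.1 Def. 2.1, §3.5 Thm. 3.13,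
  §5.2 (setting, Conj. 5.5, Thm. 5.7 — integral clause under full image of `ρ_E|_{G_K}` — Thm. 5.8,
  Rem. 5.10), §5.3 (Thm. 5.11, whose proof uses Cor. 5.4 + [CGS, Prop. 3.4.2] instead).
* [YanZhu2026] the journal version; `CyclotomicBDPCorollaryAtTrivialCharacter.lean` (the re-sourced
  input, Cor. 5.4 ∘ Prop. 3.14 ∘ [CGS 2025, Prop. 3.4.2] ∘ [CGLS 2022, Thm. 5.1.3]).
* [CastellaGrossiLeeSkinner2022] Invent. Math. 227 (2022): Thm. 5.1.3 with §5.1.2; Thm. 2.1.1.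
* [BertoliniDarmonPrasanna2013] Duke Math. J. 162: Thm. 5.13. [CastellaHsieh2018] (`L_p^BDP`).
* Tree: `BurungaleCastellaSkinner2025/BDPMainConjectureAtTrivialCharacter.lean` (File F, the `p > 3`
  (sur) twin), `CastellaGrossiLeeSkinner2022/BDPValueAtTrivialCharacter.lean` (A173, the Eisenstein
  twin), `JetchevSkinnerWan2017/AnticyclotomicControl.lean` (A174), `YanZhu2026/CyclotomicMainTheoremIntegral.lean`
  (Thm. 4.9); HOME/b2b-bsdres-lit-glue/GLUE.md GEN 6 §G6.4 (A12), GEN 7.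
-/

set_option autoImplicit false

noncomputable section

open scoped Classical

open WeierstrassCurve NumberField IsDedekindDomain Field Literature.NumberTheory.EllipticCurves
  Literature.NumberTheory.EllipticCurves.ModularForms Literature.NumberTheory.QuadraticFields
  Literature.NumberTheory.EllipticCurves.Rank1Residual
  Literature.NumberTheory.EllipticCurves.Castella2018

namespace Literature.NumberTheory.EllipticCurves.YanZhu2026

/-- **Yan–Zhu, arXiv:2412.20078v2 (2025-01-03), Theorem 4.12 (first part, with its integral clause
under (Im) AS WORDED IN v2) at the trivial character, combined with Castella–Grossi–Lee–Skinner,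
Invent. Math. 227 (2022) Theorem 5.1.3 (the Bertolini–Darmon–Prasanna formula), as Yan–Zhu's v2
proof of Thm. 4.15 (`r = 1`) combines them.** ARXIV-VERSION NOTE (module docstring): in the
refereed text v4 = J. Algebra 693 (2026) this theorem is Thm. 5.7 and its integral clause is printed
under "`ρ_E|_{G_K} : G_K → Aut_{ℤ_p}(T_pE)` is surjective", the (Im) weakening being Remark 5.10 "Via
[BSTW, Proposition 12.7]" (a preprint) — so THIS statement's (Im)-integral clause is PRE-dependent
(cell ruling R2-131.8); it is kept unchanged, and the PUBLISHED re-sourcing with the same conclusion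
is `cor54_prop342_thm513_generator_constantCoeff` (sibling file; v4's own proof of Thm. 5.11 via
Cor. 5.4 + [CGS, Prop. 3.4.2]). All numbers and quotations that follow are v2's. Setting of §4.5
(verbatim): "Let `E/ℚ` be an elliptic curve
of conductor `N`, `p > 2` a prime such that `E` has good ordinary reduction at `p`, `K` an imaginary
quadratic field such that `p = 𝔭𝔭̄` split in `K` and `(E, K)` satisfies the Heegner hypothesis.
Assume that residue representation `ρ̄_E|_{G_K} : G_K → Aut(E[p])` is irreducible." (`𝔭` "the prime
induced by `ι_p`", §1); §3.5 (standing, for `𝓛_p^BDP`): "Assume that `D_K` is odd and not equal to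
`−3`, and the Heegner hypothesis holds." Theorem 4.12 (first part, verbatim): "`𝒳_{𝓕_Gr}(E/K_∞⁻)` is
`Λ_K`-torsion and `Char_{Λ_K}(𝒳_{𝓕_ord}(E/K_∞))Λ_K^ur ⊗ ℚ_p = (𝓛_p^BDP(E/K))` holds in `Λ_K ⊗ ℚ_p`.
Moreover, if (Im) holds, then `Char_{Λ_K}(𝒳_{𝓕_ord}(E/K_∞))Λ_K^ur = (𝓛_p^BDP(E/K))`." — (Im) (§1.1):
"there exists `τ ∈ Gal(ℚ̄/ℚ(μ_{p^∞}))` such that `T_pE/(ρ_E(τ) − 1)T_pE` is free of `ℤ_p`-rank one";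
`𝒳_{𝓕_Gr}(E/K_∞⁻) = H¹_{𝓕_{rel,str}}(K, T_pE ⊗ Λ_K^{−,∨})^∨` (Def. 2.1: relaxed at `𝔭`, strict at `𝔭̄`;
the module in the two displays read as `𝒳_{𝓕_Gr}(E/K_∞⁻)`, reading flag `YZ26-412-subscript-reading`
in the module docstring); `𝓛_p^BDP(E/K) ∈ Λ_K^{ur,−} = Λ_K⁻ ⊗̂ ℤ_p^ur` the BDP `p`-adic `L`-function of
"Theorem 3.12 (CGLS)" (= CGLS 2022 Thm. 2.1.1's `𝓛_E`, [BDP13]/[CH18]). At the trivial character the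
integral clause gives: a generator `𝓕 ∈ Λ` of `ch(𝒳_{𝓕_Gr}(E/K_∞⁻))` satisfies `𝓕(0) = u ·
𝓛_p^BDP(E/K)(𝟙)` for some `u ∈ (ℤ_p^ur)^×` (two generators of a principal ideal of the domain `Λ^{ur,−}`
differ by a unit, whose constant term is a unit of `ℤ_p^ur`). CGLS Thm. 5.1.3 (verbatim, data of
§5.1.2: `E/ℚ` of conductor `N`, `π : X₀(N) → E`, `K` with the Heegner hypothesis relative to `N`, `𝔑`,
`P_K = Σ_{σ ∈ Gal(H/K)} π(x₁)^σ ∈ E(K)`, `c_E` the Manin constant, `π^*(ω_E) = c_E ω_f`): "let `p > 2`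
be a prime of good reduction for `E` such that `p = v v̄` splits in `K`. Then `𝓛_E(0) = c_E⁻² · (1 −
a_p p⁻¹ + p⁻¹)² · log_{ω_E}(P_K)²`, where `log_{ω_E} : E(K_v) → K_v` is the formal group logarithm
associated to `ω_E`". COMBINED ("the rank `1` `p`-part BSD formula comes from (the integral part of)
Theorem 4.12 and descent arguments", Yan–Zhu §4.6): `𝓕(0) = u · c_E⁻² (1 − a_p p⁻¹ + p⁻¹)²
log_{ω_E}(P_K)²`, an identity in `K_v = ℚ_p`, so that `u ∈ ℚ_p ∩ (ℤ_p^ur)^× = ℤ_p^×` whenever the value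
is non-zero (and `u := 1` serves when it is zero). TRANSCRIBED (module docstring for the dictionary):
`W` globally minimal, `3 ≤ p`, `GoodOrd W p`, `BigIm W p` (Im); `K` imaginary quadratic with the
Heegner hypothesis for `N_E`, `p` split, `D_K` odd `≠ −3`, `(W.baseChange K).HasIrreducibleModPGaloisRep p`
(`ρ̄_E|_{G_K}` irreducible); `(ι, v, vbar, κ, γ)` and `𝒳_{𝓕_Gr}(E/K_∞⁻) = AcSelmer.XAc (W.baseChange K)
p κ vbar ∅ γ` exactly as in `BurungaleCastellaSkinner2025.thm124b_thm513_generator_constantCoeff`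
(strict at `v̄`, relaxed at `v`; `K_∞`-formulation); `(Dt, H, ιC, P)` exactly as in
`display55_sha_heegnerIndex` (`Dt.c = c_E`, `ιC(P) = P_K`); `log_{ω_E}(P_K) = log_W(z(m₀ • P_ι))/m₀`
(`padicLogPoint`, `formalIndex`, `padicPointOf`); conclusion: `𝒳_{𝓕_Gr}` is `Λ`-torsion and there is a
generator `F` of `ch_Λ(𝒳_{𝓕_Gr})` and `u ∈ ℤ_p^×` with `F(0) = u · c_E⁻² · (1 − a_p p⁻¹ + p⁻¹)² ·
log_{ω_E}(P_K)²` in `ℚ_p`. COMPOSITE OF TWO PRINTED, PUBLISHED THEOREMS; nothing asserted. REFEREED;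
cell documentation flag `YZ26@3-BF-ERL-Ohta` (module docstring) on a proof-level input at `p = 3`.
[cite: YanZhu2024MainConjNonCM, Thm. 4.12 first part (§4.5, p. 11 of arXiv:2412.20078v2; = Thm. 5.7 (§5.2) of v4 = J. Algebra 693 (2026), where the integral clause is under full image of ρ_E|G_K and the (Im) form is Rem. 5.10 via [BSTW, Prop. 12.7]) with the setting of §4.5 (v4 §5.2), Conj. 4.10 (v4 Conj. 5.5), display (Im) (§1.1), §3.5 (Thm. 3.12; v4 Thm. 3.13) and the proof of Thm. 4.15 (§4.6, p. 12; v4 Thm. 5.11, proved there via Cor. 5.4 instead)]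
[cite: CastellaGrossiLeeSkinner2022, Thm. 5.1.3 (TeX `thmpadicGZ`, L2463–L2471) with §5.1.2 (L2434–L2447)]
[cite: BertoliniDarmonPrasanna2013, Thm. 5.13 (the source of Thm. 5.1.3)] -/
def thm412_thm513_generator_constantCoeff : Prop :=
  ∀ (W : WeierstrassCurve ℚ) [W.IsElliptic] [W.IsGloballyMinimal] (p : ℕ) [Fact p.Prime],
    3 ≤ p → GoodOrd W p → BigIm W p →
    ∀ (K : Type) [Field K] [NumberField K], IsImaginaryQuadratic K →
      SatisfiesHeegnerHypothesis (W.conductorNorm ℤ) K → SatisfiesHeegnerHypothesis p K →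
      Odd (NumberField.discr K) → NumberField.discr K ≠ -3 →
      (W.baseChange K).HasIrreducibleModPGaloisRep p →
    ∀ (ι : K →+* ℚ_[p]) (v vbar : HeightOneSpectrum (𝓞 K)),
      (∀ x : 𝓞 K, x ∈ v.asIdeal ↔ ‖ι (x : K)‖ < 1) →
      ((p : ℕ) : 𝓞 K) ∈ vbar.asIdeal → vbar ≠ v →
    ∀ (κ : ZpExtension K p), κ.IsAnticyclotomic →
    ∀ (γ : absoluteGaloisGroup K) [Fact (κ.IsTopGenerator γ)],
    ∀ (N : ℕ) [NeZero N] (Dt : ModularParametrizationData W N)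
      (H : HeegnerDatum N (NumberField.discr K)) (ιC : K →+* ℂ) (P : (W.baseChange K).toAffine.Point),
      WeierstrassCurve.Affine.Point.map ιC.toRatAlgHom P = heegnerPointComplex Dt H →
      Module.IsTorsion (IwasawaAlgebra p) (AcSelmer.XAc (W.baseChange K) p κ vbar ∅ γ) ∧
      ∃ F : IwasawaAlgebra p,
        AcSelmer.XAc.charIdeal (W.baseChange K) p κ vbar ∅ γ = Ideal.span {F} ∧
        ∃ u : ℤ_[p]ˣ,
          ((PowerSeries.constantCoeff F : ℤ_[p]) : ℚ_[p]) =
            ((u : ℤ_[p]) : ℚ_[p]) * ((Dt.c : ℚ_[p])⁻¹) ^ 2 *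
              (1 - (W.frobeniusTrace p : ℚ_[p]) * (p : ℚ_[p])⁻¹ + (p : ℚ_[p])⁻¹) ^ 2 *
              ((W.baseChange ℚ_[p]).padicLogPoint (formalIndex W p • padicPointOf W p ι P) /
                (formalIndex W p : ℚ_[p])) ^ 2

/-! ### A `p`-adic valuation computation (standard API; no mathematical content of its own) -/

section Valuation

variable {p : ℕ} [hp : Fact p.Prime]

/-- `ord_p` of the right-hand side of Thm. 4.12 ∘ Thm. 5.1.3: for a unit `u ∈ ℤ_p^×`, integers
`c, a`, `L ∈ ℚ_p` and `m ∈ ℕ`, if `u · c⁻² · (1 − a p⁻¹ + p⁻¹)² · (L/m)² ≠ 0` then its valuation is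
`2·(ord_p(1 − a + p) − 1 + (ord_p L − ord_p m)) − 2·ord_p c` (each factor is non-zero, `ord_p` is
additive, `1 − a p⁻¹ + p⁻¹ = (1 − a + p)/p`). Private helper (the same computation as in File F / A173,
whose copies are private to their modules). [folklore] -/
private theorem valuation_unit_mul_bdpShape_yz (u : ℤ_[p]ˣ) (c a : ℤ) (L : ℚ_[p]) (m : ℕ)
    (h : ((u : ℤ_[p]) : ℚ_[p]) * ((c : ℚ_[p])⁻¹) ^ 2 *
        (1 - (a : ℚ_[p]) * (p : ℚ_[p])⁻¹ + (p : ℚ_[p])⁻¹) ^ 2 * (L / (m : ℚ_[p])) ^ 2 ≠ 0) :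
    (((u : ℤ_[p]) : ℚ_[p]) * ((c : ℚ_[p])⁻¹) ^ 2 *
        (1 - (a : ℚ_[p]) * (p : ℚ_[p])⁻¹ + (p : ℚ_[p])⁻¹) ^ 2 * (L / (m : ℚ_[p])) ^ 2).valuation =
      2 * ((padicValInt p (1 - a + p) : ℤ) - 1 + (L.valuation - (padicValNat p m : ℤ))) -
        2 * (padicValInt p c : ℤ) := by
  have hp0 : (p : ℚ_[p]) ≠ 0 := by exact_mod_cast hp.out.ne_zero
  have hu0 : ((u : ℤ_[p]) : ℚ_[p]) ≠ 0 := PadicInt.coe_ne_zero.2 u.ne_zero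
  have hc0 : ((c : ℚ_[p])⁻¹) ≠ 0 := by
    intro h0; apply h; rw [h0]; ring
  have hA0 : (1 - (a : ℚ_[p]) * (p : ℚ_[p])⁻¹ + (p : ℚ_[p])⁻¹) ≠ 0 := by
    intro h0; apply h; rw [h0]; ring
  have hLm0 : L / (m : ℚ_[p]) ≠ 0 := by
    intro h0; apply h; rw [h0]; ring
  have hL0 : L ≠ 0 := by
    intro h0; apply hLm0; rw [h0, zero_div]
  have hm0 : (m : ℚ_[p]) ≠ 0 := by
    intro h0; apply hLm0; rw [h0, div_zero]
  -- `1 − a p⁻¹ + p⁻¹ = (1 − a + p)/p`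
  have hAeq : (1 - (a : ℚ_[p]) * (p : ℚ_[p])⁻¹ + (p : ℚ_[p])⁻¹) =
      ((1 - a + p : ℤ) : ℚ_[p]) * (p : ℚ_[p])⁻¹ := by
    push_cast
    field_simp
    ring
  have hA1 : ((1 - a + p : ℤ) : ℚ_[p]) ≠ 0 := by
    intro h0; apply hA0; rw [hAeq, h0, zero_mul]
  -- valuations of the four factors
  have hvu : ((u : ℤ_[p]) : ℚ_[p]).valuation = 0 := by
    simp only [PadicInt.valuation_coe, padicInt_valuation_eq_zero_of_isUnit u.isUnit, Nat.cast_zero]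
  have hvc : ((c : ℚ_[p])⁻¹).valuation = -(padicValInt p c : ℤ) := by
    rw [Padic.valuation_inv, Padic.valuation_intCast]
  have hvA : (1 - (a : ℚ_[p]) * (p : ℚ_[p])⁻¹ + (p : ℚ_[p])⁻¹).valuation =
      (padicValInt p (1 - a + p) : ℤ) - 1 := by
    rw [hAeq, Padic.valuation_mul hA1 (inv_ne_zero hp0), Padic.valuation_intCast,
      Padic.valuation_inv, Padic.valuation_p]
    ring
  have hvL : (L / (m : ℚ_[p])).valuation = L.valuation - (padicValNat p m : ℤ) := by
    rw [div_eq_mul_inv, Padic.valuation_mul hL0 (inv_ne_zero hm0), Padic.valuation_inv,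
      Padic.valuation_natCast]
    ring
  rw [Padic.valuation_mul (mul_ne_zero (mul_ne_zero hu0 (pow_ne_zero 2 hc0)) (pow_ne_zero 2 hA0))
      (pow_ne_zero 2 hLm0),
    Padic.valuation_mul (mul_ne_zero hu0 (pow_ne_zero 2 hc0)) (pow_ne_zero 2 hA0),
    Padic.valuation_mul hu0 (pow_ne_zero 2 hc0), Padic.valuation_pow, Padic.valuation_pow,
    Padic.valuation_pow, hvu, hvc, hvA, hvL]
  ring

end Valuation

variable {W : WeierstrassCurve ℚ} [W.IsElliptic] [W.IsGloballyMinimal] {p : ℕ} [Fact p.Prime]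

/-! ### Bookkeeping consumers -/

/-- **Every generator satisfies the identity (with its own unit).** Granted the fact, if
`ch_Λ(𝒳_{𝓕_Gr}) = (𝓖)` for ANY `𝓖 ∈ Λ`, then `𝓖(0) = u' · c_E⁻² (1 − a_p p⁻¹ + p⁻¹)² log_{ω_E}(P_K)²`
for some `u' ∈ ℤ_p^×` (two generators of a principal ideal of the domain `Λ = ℤ_p⟦T⟧` differ by a unit
of `Λ`, whose constant term is a unit of `ℤ_p`).
[cite: YanZhu2024MainConjNonCM, Thm. 4.12 first part (§4.5, p. 11 of arXiv v2; v4 Thm. 5.7, ARXIV-VERSION NOTE)] -/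
theorem generator_constantCoeff_eq_of_thm412 (h : thm412_thm513_generator_constantCoeff)
    (hp : 3 ≤ p) (hord : GoodOrd W p) (him : BigIm W p)
    (K : Type) [Field K] [NumberField K] (hK : IsImaginaryQuadratic K)
    (hHN : SatisfiesHeegnerHypothesis (W.conductorNorm ℤ) K) (hHp : SatisfiesHeegnerHypothesis p K)
    (hodd : Odd (NumberField.discr K)) (h3 : NumberField.discr K ≠ -3)
    (hirr : (W.baseChange K).HasIrreducibleModPGaloisRep p)
    (ι : K →+* ℚ_[p]) (v vbar : HeightOneSpectrum (𝓞 K))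
    (hv : ∀ x : 𝓞 K, x ∈ v.asIdeal ↔ ‖ι (x : K)‖ < 1)
    (hvbar : ((p : ℕ) : 𝓞 K) ∈ vbar.asIdeal) (hne : vbar ≠ v)
    (κ : ZpExtension K p) (hκ : κ.IsAnticyclotomic)
    (γ : absoluteGaloisGroup K) [Fact (κ.IsTopGenerator γ)]
    {N : ℕ} [NeZero N] (Dt : ModularParametrizationData W N)
    (H : HeegnerDatum N (NumberField.discr K)) (ιC : K →+* ℂ) (P : (W.baseChange K).toAffine.Point)
    (hP : WeierstrassCurve.Affine.Point.map ιC.toRatAlgHom P = heegnerPointComplex Dt H)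
    (G : IwasawaAlgebra p) (hG : AcSelmer.XAc.charIdeal (W.baseChange K) p κ vbar ∅ γ = Ideal.span {G}) :
    ∃ u' : ℤ_[p]ˣ,
      ((PowerSeries.constantCoeff G : ℤ_[p]) : ℚ_[p]) =
        ((u' : ℤ_[p]) : ℚ_[p]) * ((Dt.c : ℚ_[p])⁻¹) ^ 2 *
          (1 - (W.frobeniusTrace p : ℚ_[p]) * (p : ℚ_[p])⁻¹ + (p : ℚ_[p])⁻¹) ^ 2 *
          ((W.baseChange ℚ_[p]).padicLogPoint (formalIndex W p • padicPointOf W p ι P) /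
            (formalIndex W p : ℚ_[p])) ^ 2 := by
  obtain ⟨-, F, hF, u, hu⟩ :=
    h W p hp hord him K hK hHN hHp hodd h3 hirr ι v vbar hv hvbar hne κ hκ γ N Dt H ιC P hP
  -- `G = F · w` for a unit `w` of `Λ`; `w(0)` is a unit of `ℤ_p`
  obtain ⟨w, rfl⟩ := Ideal.span_singleton_eq_span_singleton.mp (hF.symm.trans hG)
  have hw : IsUnit (PowerSeries.constantCoeff (w : IwasawaAlgebra p)) :=
    PowerSeries.isUnit_constantCoeff _ w.isUnit
  refine ⟨u * hw.unit, ?_⟩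
  rw [map_mul, PadicInt.coe_mul, hu, Units.val_mul, PadicInt.coe_mul, IsUnit.unit_spec]
  ring

/-- **The identity in valuations** — the currency of the control facts (JSW 3.3.1 = A174, CGLS 5.1.1
= A170) and of the cell's `AcSelmer.XAc.HasCharValuationAt`: granted the fact, for EVERY generator
`𝓖` of `ch_Λ(𝒳_{𝓕_Gr})` with `𝓖(0) ≠ 0`, `ord_p 𝓖(0) = 2·(ord_p(1 − a_p + p) − 1 + ord_p log_{ω_E} P_K)
− 2·ord_p c_E`, where `ord_p log_{ω_E} P_K = padicLogOrd W p ι P`.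
[cite: YanZhu2024MainConjNonCM, Thm. 4.12 first part (§4.5, p. 11 of arXiv v2; v4 Thm. 5.7) with the proof of Thm. 4.15 (§4.6, p. 12 of v2; v4 Thm. 5.11)]
[cite: CastellaGrossiLeeSkinner2022, Thm. 5.1.3] -/
theorem valuation_generator_constantCoeff_of_thm412 (h : thm412_thm513_generator_constantCoeff)
    (hp : 3 ≤ p) (hord : GoodOrd W p) (him : BigIm W p)
    (K : Type) [Field K] [NumberField K] (hK : IsImaginaryQuadratic K)
    (hHN : SatisfiesHeegnerHypothesis (W.conductorNorm ℤ) K) (hHp : SatisfiesHeegnerHypothesis p K)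
    (hodd : Odd (NumberField.discr K)) (h3 : NumberField.discr K ≠ -3)
    (hirr : (W.baseChange K).HasIrreducibleModPGaloisRep p)
    (ι : K →+* ℚ_[p]) (v vbar : HeightOneSpectrum (𝓞 K))
    (hv : ∀ x : 𝓞 K, x ∈ v.asIdeal ↔ ‖ι (x : K)‖ < 1)
    (hvbar : ((p : ℕ) : 𝓞 K) ∈ vbar.asIdeal) (hne : vbar ≠ v)
    (κ : ZpExtension K p) (hκ : κ.IsAnticyclotomic)
    (γ : absoluteGaloisGroup K) [Fact (κ.IsTopGenerator γ)]
    {N : ℕ} [NeZero N] (Dt : ModularParametrizationData W N)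
    (H : HeegnerDatum N (NumberField.discr K)) (ιC : K →+* ℂ) (P : (W.baseChange K).toAffine.Point)
    (hP : WeierstrassCurve.Affine.Point.map ιC.toRatAlgHom P = heegnerPointComplex Dt H)
    (G : IwasawaAlgebra p) (hG : AcSelmer.XAc.charIdeal (W.baseChange K) p κ vbar ∅ γ = Ideal.span {G})
    (hG0 : PowerSeries.constantCoeff G ≠ 0) :
    ((PowerSeries.constantCoeff G).valuation : ℤ) =
      2 * ((padicValInt p (1 - W.frobeniusTrace p + p) : ℤ) - 1 + padicLogOrd W p ι P) -
        2 * (padicValInt p Dt.c : ℤ) := by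
  obtain ⟨u', hu'⟩ := generator_constantCoeff_eq_of_thm412 h hp hord him K hK hHN hHp hodd h3 hirr
    ι v vbar hv hvbar hne κ hκ γ Dt H ιC P hP G hG
  -- the left-hand side is non-zero, hence so is the right-hand side
  have hrhs : ((u' : ℤ_[p]) : ℚ_[p]) * ((Dt.c : ℚ_[p])⁻¹) ^ 2 *
      (1 - (W.frobeniusTrace p : ℚ_[p]) * (p : ℚ_[p])⁻¹ + (p : ℚ_[p])⁻¹) ^ 2 *
      ((W.baseChange ℚ_[p]).padicLogPoint (formalIndex W p • padicPointOf W p ι P) /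
        (formalIndex W p : ℚ_[p])) ^ 2 ≠ 0 := by
    rw [← hu']
    exact PadicInt.coe_ne_zero.2 hG0
  have hval := congrArg Padic.valuation hu'
  rw [PadicInt.valuation_coe, valuation_unit_mul_bdpShape_yz u' Dt.c (W.frobeniusTrace p) _ _ hrhs]
    at hval
  rw [hval, padicLogOrd]

/-- **Thm. 4.12 (first part, integral) ∘ Thm. 5.1.3 at the trivial character in the packaged currency**
`AcSelmer.XAc.HasCharValuationAt … n` ("`𝒳_{𝓕_Gr}` is `Λ`-torsion with a generator `𝓕`, `𝓕(0) ≠ 0`,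
`ord_p 𝓕(0) = n`") `∧ n = 2·(ord_p(1 − a_p + p) − 1 + ord_p log_{ω_E} P_K) − 2·ord_p c_E` — granted
the fact and ONE generator with non-zero constant term (at the cell's data this comes from a control
theorem: JSW Thm. 3.3.1 at every pair, CGLS Thm. 5.1.1 off the anomalous line). Up to the Manin term
`2·ord_p c_E` (absent for a parametrisation with `p ∤ c_E`) and the log-prime convention (CGLS's:
log at the prime `v` induced by `ι`, module strict at `v̄`) this is LITERALLY the body of the cell's
Summits predicate `X11b.IMCWaldspurgerOnTreeGoodAt p κ vbar γ ι P` ((IMC∘BDP)ᵍ at `𝟙`), now fed, at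
an ODD good ordinary `p` with (Im) and (irr_K) — in particular at `p = 3` — by a published fact.
[cite: YanZhu2024MainConjNonCM, Thm. 4.12 first part (§4.5, p. 11 of arXiv v2; v4 Thm. 5.7), proof of Thm. 4.15 (§4.6, p. 12 of v2; v4 Thm. 5.11)]
[cite: CastellaGrossiLeeSkinner2022, Thm. 5.1.3] [cite: Castella2018, §5 (eq:IMC+BDP) (arXiv:1704.06608 p. 12) (the same shape at `p ∣ N`)] -/
theorem hasCharValuationAt_of_thm412 (h : thm412_thm513_generator_constantCoeff)
    (hp : 3 ≤ p) (hord : GoodOrd W p) (him : BigIm W p)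
    (K : Type) [Field K] [NumberField K] (hK : IsImaginaryQuadratic K)
    (hHN : SatisfiesHeegnerHypothesis (W.conductorNorm ℤ) K) (hHp : SatisfiesHeegnerHypothesis p K)
    (hodd : Odd (NumberField.discr K)) (h3 : NumberField.discr K ≠ -3)
    (hirr : (W.baseChange K).HasIrreducibleModPGaloisRep p)
    (ι : K →+* ℚ_[p]) (v vbar : HeightOneSpectrum (𝓞 K))
    (hv : ∀ x : 𝓞 K, x ∈ v.asIdeal ↔ ‖ι (x : K)‖ < 1)
    (hvbar : ((p : ℕ) : 𝓞 K) ∈ vbar.asIdeal) (hne : vbar ≠ v)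
    (κ : ZpExtension K p) (hκ : κ.IsAnticyclotomic)
    (γ : absoluteGaloisGroup K) [Fact (κ.IsTopGenerator γ)]
    {N : ℕ} [NeZero N] (Dt : ModularParametrizationData W N)
    (H : HeegnerDatum N (NumberField.discr K)) (ιC : K →+* ℂ) (P : (W.baseChange K).toAffine.Point)
    (hP : WeierstrassCurve.Affine.Point.map ιC.toRatAlgHom P = heegnerPointComplex Dt H)
    (G : IwasawaAlgebra p) (hG : AcSelmer.XAc.charIdeal (W.baseChange K) p κ vbar ∅ γ = Ideal.span {G})
    (hG0 : PowerSeries.constantCoeff G ≠ 0) :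
    ∃ n : ℕ, AcSelmer.XAc.HasCharValuationAt (W.baseChange K) p κ vbar ∅ γ n ∧
      (n : ℤ) = 2 * ((padicValInt p (1 - W.frobeniusTrace p + p) : ℤ) - 1 + padicLogOrd W p ι P) -
        2 * (padicValInt p Dt.c : ℤ) := by
  obtain ⟨htors, -⟩ :=
    h W p hp hord him K hK hHN hHp hodd h3 hirr ι v vbar hv hvbar hne κ hκ γ N Dt H ιC P hP
  exact ⟨(PowerSeries.constantCoeff G).valuation,
    AcSelmer.XAc.hasCharValuationAt_of_eq htors hG hG0 rfl,
    valuation_generator_constantCoeff_of_thm412 h hp hord him K hK hHN hHp hodd h3 hirr ι v vbar hv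
      hvbar hne κ hκ γ Dt H ιC P hP G hG hG0⟩

/-- **Bookkeeping: the File-F-keyed form.** On the locus `3 < p` of
`BurungaleCastellaSkinner2025.thm124b_thm513_generator_constantCoeff` (BCS 2025 Thm. 1.2.4 (b),
hypothesis (sur)), granted ANY bridge `Surj W p → BigIm W p` at the pair (in the tree:
`X9.bigIm_of_surj` for `p ≥ 5`, Summits side) the Yan–Zhu fact yields File F's conclusion under File
F's binders PLUS (irr_K) — so every consumer written against File F re-keys to this fact by supplying
(irr_K) (which the consumers of the control fact JSW 3.3.1 already carry). Rem. 1.3 of the source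
(arXiv v2 wording; Rem. 1.3 is rewritten in v4): "Their results don't cover ours, nor do ours cover
theirs." — the two facts are kept side by side; neither is derived from the other.
[cite: YanZhu2024MainConjNonCM, Thm. 4.12 (arXiv v2; v4 Thm. 5.7), Rem. 1.3 (arXiv v2)] -/
theorem thm412_of_bigIm_imp (h : thm412_thm513_generator_constantCoeff)
    (hbig : Surj W p → BigIm W p)
    (hp : 3 < p) (hord : GoodOrd W p) (hsurj : Surj W p)
    (K : Type) [Field K] [NumberField K] (hK : IsImaginaryQuadratic K)
    (hHN : SatisfiesHeegnerHypothesis (W.conductorNorm ℤ) K) (hHp : SatisfiesHeegnerHypothesis p K)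
    (hodd : Odd (NumberField.discr K)) (h3 : NumberField.discr K ≠ -3)
    (hirr : (W.baseChange K).HasIrreducibleModPGaloisRep p)
    (ι : K →+* ℚ_[p]) (v vbar : HeightOneSpectrum (𝓞 K))
    (hv : ∀ x : 𝓞 K, x ∈ v.asIdeal ↔ ‖ι (x : K)‖ < 1)
    (hvbar : ((p : ℕ) : 𝓞 K) ∈ vbar.asIdeal) (hne : vbar ≠ v)
    (κ : ZpExtension K p) (hκ : κ.IsAnticyclotomic)
    (γ : absoluteGaloisGroup K) [Fact (κ.IsTopGenerator γ)]
    {N : ℕ} [NeZero N] (Dt : ModularParametrizationData W N)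
    (H : HeegnerDatum N (NumberField.discr K)) (ιC : K →+* ℂ) (P : (W.baseChange K).toAffine.Point)
    (hP : WeierstrassCurve.Affine.Point.map ιC.toRatAlgHom P = heegnerPointComplex Dt H) :
    Module.IsTorsion (IwasawaAlgebra p) (AcSelmer.XAc (W.baseChange K) p κ vbar ∅ γ) ∧
      ∃ F : IwasawaAlgebra p,
        AcSelmer.XAc.charIdeal (W.baseChange K) p κ vbar ∅ γ = Ideal.span {F} ∧
        ∃ u : ℤ_[p]ˣ,
          ((PowerSeries.constantCoeff F : ℤ_[p]) : ℚ_[p]) =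
            ((u : ℤ_[p]) : ℚ_[p]) * ((Dt.c : ℚ_[p])⁻¹) ^ 2 *
              (1 - (W.frobeniusTrace p : ℚ_[p]) * (p : ℚ_[p])⁻¹ + (p : ℚ_[p])⁻¹) ^ 2 *
              ((W.baseChange ℚ_[p]).padicLogPoint (formalIndex W p • padicPointOf W p ι P) /
                (formalIndex W p : ℚ_[p])) ^ 2 :=
  h W p (le_of_lt hp) hord (hbig hsurj) K hK hHN hHp hodd h3 hirr ι v vbar hv hvbar hne κ hκ γ N Dt H
    ιC P hP

end Literature.NumberTheory.EllipticCurves.YanZhu2026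

end
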